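import Summits.QuantumFields.BalabanUV.Beta.GAN24.ResolventCurveTaylor

/-!
# `BalabanUV.Beta.GAN24.ResolventMixedPartials` — binder row G-an2-4 ∕ (CONV-C), route R7 «TWO CURRENCIES», PART 251: THE MIXED SECOND PARTIAL OF THE INVERSE OF A RESOLVENT
# READ-OUT — POLARISATION.  The one-loop vacuum-polarisation tensor is the SYMMETRIC BILINEAR form of second derivatives of the effective action in the background; along a TWO-parameter
# family `(s, r) ↦ D + P(s, r)` its off-diagonal entry is the MIXED partial `∂_r|₀∂_s|₀[(Φ(D + P(s, r))⁻¹)⁻¹]`.  GENERIC file (any square complex matrices, any continuous linear read-out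
# `Φ`, REAL parameters — the background enters the covariant Laplacian through `U` AND `U*`): (§1) the point version of PART 240's letter derivative and the EXPLICIT second derivative
# along a jet-tower curve, `∂²_s[(ΦR)⁻¹] = 2·EΦ(RP₁R)EΦ(RP₁R)E − 2·EΦ(RP₁RP₁R)E + EΦ(RP₂R)E` (PART 240 gave it as SOME uniform `ℤ`-combination of diagrams); (§2) the mixed partial from
# SEPARATE partial jets — `s ↦ P(s, r)` differentiable at `s = 0` with derivative `P₁₀(r)` for every `r`, `r ↦ P(0, r)` with derivative `P₀₁` and `r ↦ P₁₀(r)` with derivative `P₁₁` at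
# `r = 0` — as the explicit five-diagram combination `EΦ(RbR)EΦ(RaR)E + EΦ(RaR)EΦ(RbR)E − EΦ(RbRaR)E − EΦ(RaRbR)E + EΦ(RcR)E` (`a = P₁₀(0)`, `b = P₀₁`, `c = P₁₁`; no joint
# differentiability is assumed: the mixed partial is the iterated one-variable derivative `deriv (r ↦ deriv (s ↦ ·) 0) 0`); (§3) the POLARISATION IDENTITY — pure algebra: if the
# diagonal curve has first jet `a + b` and second jet `a₂ + 2c + b₂`, the five-diagram combination is `½(∂²|₀ along the diagonal − ∂²|₀ along the first axis − ∂²|₀ along the second)`;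
# (§4) the three statements composed.  PART 252 computes the partial jets of the two-parameter exponential chart `exp(iη(sA + rB))`; PART 253 reads the exact abelian covariant
# Laplacian on it (unit b2b-balaban-gan24-p3, gen 66; v1)

NOT IN PRINT; OUR PROOF ([folklore] matrix calculus over `ℝ` on `Matrix m m ℂ` with the scoped `ℓ²`-operator norm: PART 240's `hasDerivAt_nonsing_inv_real`, `hasDerivAt_readout`,
`hasDerivAt_resolventCurve`, `isOpen_resolventCurveSet`; Mathlib's `HasDerivAt.fun_mul`, `HasDerivAt.congr_of_eventuallyEq`, `Filter.EventuallyEq.deriv_eq`, `ContinuousAt.eventually_ne`,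
`iteratedDeriv_succ`; nothing printed is a hypothesis).
HONEST FRAMING (cell contract, verbatim): «discharging `BetaPertH` makes Bałaban's UV stability UNCONDITIONAL — a real constructive-QFT result; it is NOT the
continuum limit and NOT the Clay problem.»  HONEST DEPENDENCY (verbatim): «continuum YM on T⁴ ⇐ BetaPertH ∧ nine spine estimates (0/9 proved); BetaPertH ⇐
(D1) ∧ (D4) ∧ CAP+tail; G-an2-4 gates asym, D1 and NE2/3/4.»

WHAT THIS FILE PROVES (0 sorry, 0 `def`; `m, n` finite types, `D : Matrix m m ℂ`, `Φ : Matrix m m ℂ →L[ℂ] Matrix n n ℂ`; `R = (D + P)⁻¹`, `E = (ΦR)⁻¹` at the base point):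
* §1 **`hasDerivAt_inv_readout_pt`** (`∂_s[(Φ(D + P(s))⁻¹)⁻¹] = E·Φ(R·P′·R)·E` from the derivative `P′` of `P` at ONE point), `deriv_inv_readout_pt`, `hasDerivAt_resolvent_sandwich`
  (`∂_s(RP₁R)` along a jet tower), **`hasDerivAt_firstDiagram_curve`**, **`iteratedDeriv_two_inv_readout_curve`** (the explicit second derivative along a jet-tower curve at every good `s`).
* §2 `eventually_isUnit_two_param` (the good set in `r` is a neighbourhood of `0`), **`hasDerivAt_deriv_inv_readout_two_param`**, **`deriv_deriv_inv_readout_two_param`** (the mixed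
  partial `∂_r|₀∂_s|₀` as the explicit five-diagram combination in `a = P₁₀(0)`, `b = P₀₁`, `c = P₁₁`).
* §3 **`two_smul_mixedDiagram_eq_polarisation`**, **`mixedDiagram_eq_half_polarisation`** (the algebraic polarisation identity).
* §4 **`deriv_deriv_eq_half_polarisation`** (§2 + §1 + §3: the mixed partial of the two-parameter family is `½(∂²|₀` along the diagonal jet-tower curve `− ∂²|₀` along the first `− ∂²|₀`
  along the second`)` whenever the three one-parameter curves pass through the same base point with first jets `a + b`, `a`, `b` and second jets `a₂ + 2c + b₂`, `a₂`, `b₂`).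
WHAT IT DOES NOT DO: joint (Fréchet) differentiability in `(s, r)` (not needed and not claimed); higher mixed partials; the jets of a concrete chart (PART 252) and the END (PART 253).
SUPPLIER work; NEVER «G-an2-4 closed»; NOT (CONV-C), NOT D1, NOT `BetaPertH`, NOT continuum, NOT Clay.  Records: `HOME/b2b-balaban-gan24-p3/gen66/README.md`.
-/

noncomputable section

open scoped BigOperators ComplexConjugate Matrix Matrix.Norms.L2Operator
open Filter Topology

namespace Summit.QuantumFields.BalabanUV.Beta.GAN24.ResolventMixedPartials

open Summit.QuantumFields.BalabanUV.Beta.GAN24.ResolventCurveTaylor (hasDerivAt_nonsing_inv_real hasDerivAt_readout hasDerivAt_resolventCurve isOpen_resolventCurveSet)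

/-! ## §1 Point version of the letter derivative; the explicit second derivative along a jet-tower curve -/

section Curve

variable {m n : Type*} [Fintype m] [DecidableEq m] [Fintype n] [DecidableEq n]

/-- **`hasDerivAt_inv_readout_pt`** — if `s ↦ P(s)` has derivative `P′` at `s₀` and `D + P(s₀)`, `Φ((D + P(s₀))⁻¹)` are invertible, then `s ↦ (Φ(D + P(s))⁻¹)⁻¹` has derivative
`E·Φ(R·P′·R)·E` at `s₀` (`R = (D + P(s₀))⁻¹`, `E = (ΦR)⁻¹`; the point version of PART 240's `hasDerivAt_curveLetter_none`). [folklore] -/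
theorem hasDerivAt_inv_readout_pt (D : Matrix m m ℂ) (Φ : Matrix m m ℂ →L[ℂ] Matrix n n ℂ) {P : ℝ → Matrix m m ℂ} {P' : Matrix m m ℂ} {s : ℝ}
    (hP : HasDerivAt P P' s) (hs : IsUnit (D + P s).det) (hc : IsUnit (Φ (D + P s)⁻¹).det) :
    HasDerivAt (fun v : ℝ => (Φ (D + P v)⁻¹)⁻¹) ((Φ (D + P s)⁻¹)⁻¹ * Φ ((D + P s)⁻¹ * P' * (D + P s)⁻¹) * (Φ (D + P s)⁻¹)⁻¹) s := by
  have h1 : HasDerivAt (fun v : ℝ => (D + P v)⁻¹) (-((D + P s)⁻¹ * P' * (D + P s)⁻¹)) s := hasDerivAt_nonsing_inv_real (hP.const_add D) hs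
  have h2 : HasDerivAt (fun v : ℝ => Φ (D + P v)⁻¹) (Φ (-((D + P s)⁻¹ * P' * (D + P s)⁻¹))) s := hasDerivAt_readout Φ h1
  have h3 := hasDerivAt_nonsing_inv_real h2 hc
  refine h3.congr_deriv ?_
  rw [map_neg, Matrix.mul_neg, Matrix.neg_mul, neg_neg]

/-- `deriv` form of `hasDerivAt_inv_readout_pt`. [folklore] -/
theorem deriv_inv_readout_pt (D : Matrix m m ℂ) (Φ : Matrix m m ℂ →L[ℂ] Matrix n n ℂ) {P : ℝ → Matrix m m ℂ} {P' : Matrix m m ℂ} {s : ℝ}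
    (hP : HasDerivAt P P' s) (hs : IsUnit (D + P s).det) (hc : IsUnit (Φ (D + P s)⁻¹).det) :
    deriv (fun v : ℝ => (Φ (D + P v)⁻¹)⁻¹) s = (Φ (D + P s)⁻¹)⁻¹ * Φ ((D + P s)⁻¹ * P' * (D + P s)⁻¹) * (Φ (D + P s)⁻¹)⁻¹ :=
  (hasDerivAt_inv_readout_pt D Φ hP hs hc).deriv

omit [Fintype n] [DecidableEq n] in
/-- the resolvent sandwich `R·P₁·R` along a jet-tower curve (`∂_sP_j = P_{j+1}`, `R′ = −RP₁R`): `∂_s(R·P₁·R) = −RP₁RP₁R + RP₂R − RP₁RP₁R`. [folklore] -/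
theorem hasDerivAt_resolvent_sandwich (D : Matrix m m ℂ) {Pd : ℕ → ℝ → Matrix m m ℂ} (hPd : ∀ j v, HasDerivAt (Pd j) (Pd (j + 1) v) v) {s : ℝ}
    (hs : IsUnit (D + Pd 0 s).det) :
    HasDerivAt (fun v : ℝ => (D + Pd 0 v)⁻¹ * Pd 1 v * (D + Pd 0 v)⁻¹)
      (-((D + Pd 0 s)⁻¹ * Pd 1 s * (D + Pd 0 s)⁻¹ * Pd 1 s * (D + Pd 0 s)⁻¹) + (D + Pd 0 s)⁻¹ * Pd 2 s * (D + Pd 0 s)⁻¹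
        - (D + Pd 0 s)⁻¹ * Pd 1 s * (D + Pd 0 s)⁻¹ * Pd 1 s * (D + Pd 0 s)⁻¹) s := by
  have hR := hasDerivAt_resolventCurve D hPd hs
  have h := (hR.fun_mul (hPd 1 s)).fun_mul hR
  refine h.congr_deriv ?_
  simp only [Matrix.mul_neg, Matrix.neg_mul, Matrix.add_mul, Matrix.mul_assoc]
  abel

/-- **`hasDerivAt_firstDiagram_curve` — THE FIRST DIAGRAM DIFFERENTIATES INTO THE SECOND**: along a jet-tower curve, at a good `s`,
`∂_s[E·Φ(R·P₁·R)·E] = 2·EΦ(RP₁R)EΦ(RP₁R)E − 2·EΦ(RP₁RP₁R)E + EΦ(RP₂R)E` (`E′ = EΦ(RP₁R)E`, `(RP₁R)′ = −RP₁RP₁R + RP₂R − RP₁RP₁R`). [folklore] -/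
theorem hasDerivAt_firstDiagram_curve (D : Matrix m m ℂ) (Φ : Matrix m m ℂ →L[ℂ] Matrix n n ℂ) {Pd : ℕ → ℝ → Matrix m m ℂ} (hPd : ∀ j v, HasDerivAt (Pd j) (Pd (j + 1) v) v)
    {s : ℝ} (hs : IsUnit (D + Pd 0 s).det) (hc : IsUnit (Φ (D + Pd 0 s)⁻¹).det) :
    HasDerivAt (fun v : ℝ => (Φ (D + Pd 0 v)⁻¹)⁻¹ * Φ ((D + Pd 0 v)⁻¹ * Pd 1 v * (D + Pd 0 v)⁻¹) * (Φ (D + Pd 0 v)⁻¹)⁻¹)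
      ((2 : ℂ) • ((Φ (D + Pd 0 s)⁻¹)⁻¹ * Φ ((D + Pd 0 s)⁻¹ * Pd 1 s * (D + Pd 0 s)⁻¹) * (Φ (D + Pd 0 s)⁻¹)⁻¹
          * Φ ((D + Pd 0 s)⁻¹ * Pd 1 s * (D + Pd 0 s)⁻¹) * (Φ (D + Pd 0 s)⁻¹)⁻¹)
        - (2 : ℂ) • ((Φ (D + Pd 0 s)⁻¹)⁻¹ * Φ ((D + Pd 0 s)⁻¹ * Pd 1 s * (D + Pd 0 s)⁻¹ * Pd 1 s * (D + Pd 0 s)⁻¹) * (Φ (D + Pd 0 s)⁻¹)⁻¹)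
        + (Φ (D + Pd 0 s)⁻¹)⁻¹ * Φ ((D + Pd 0 s)⁻¹ * Pd 2 s * (D + Pd 0 s)⁻¹) * (Φ (D + Pd 0 s)⁻¹)⁻¹) s := by
  have hE : HasDerivAt (fun v : ℝ => (Φ (D + Pd 0 v)⁻¹)⁻¹)
      ((Φ (D + Pd 0 s)⁻¹)⁻¹ * Φ ((D + Pd 0 s)⁻¹ * Pd 1 s * (D + Pd 0 s)⁻¹) * (Φ (D + Pd 0 s)⁻¹)⁻¹) s :=
    hasDerivAt_inv_readout_pt D Φ (hPd 0 s) hs hc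
  have hW := hasDerivAt_readout Φ (hasDerivAt_resolvent_sandwich D hPd hs)
  have h := (hE.fun_mul hW).fun_mul hE
  refine h.congr_deriv ?_
  simp only [map_add, map_sub, map_neg, Matrix.mul_add, Matrix.add_mul, Matrix.mul_sub, Matrix.sub_mul, Matrix.mul_neg, Matrix.neg_mul, Matrix.mul_assoc,
    two_smul]
  abel

/-- **`iteratedDeriv_two_inv_readout_curve` — THE EXPLICIT SECOND DERIVATIVE OF `(ΦR)⁻¹` ALONG A JET-TOWER CURVE**: at every good `s`,
`∂²_s[(Φ(D + P(s))⁻¹)⁻¹] = 2·EΦ(RP₁R)EΦ(RP₁R)E − 2·EΦ(RP₁RP₁R)E + EΦ(RP₂R)E` (the good set is open, so `deriv` agrees with the first diagram near `s`; then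
`hasDerivAt_firstDiagram_curve`).  PART 240's `iteratedDeriv_inv_eq_curveDiagramSum 2` made explicit. [folklore] -/
theorem iteratedDeriv_two_inv_readout_curve (D : Matrix m m ℂ) (Φ : Matrix m m ℂ →L[ℂ] Matrix n n ℂ) {Pd : ℕ → ℝ → Matrix m m ℂ}
    (hPd : ∀ j v, HasDerivAt (Pd j) (Pd (j + 1) v) v) {s : ℝ} (hs : IsUnit (D + Pd 0 s).det) (hc : IsUnit (Φ (D + Pd 0 s)⁻¹).det) :
    iteratedDeriv 2 (fun v : ℝ => (Φ (D + Pd 0 v)⁻¹)⁻¹) s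
      = (2 : ℂ) • ((Φ (D + Pd 0 s)⁻¹)⁻¹ * Φ ((D + Pd 0 s)⁻¹ * Pd 1 s * (D + Pd 0 s)⁻¹) * (Φ (D + Pd 0 s)⁻¹)⁻¹
          * Φ ((D + Pd 0 s)⁻¹ * Pd 1 s * (D + Pd 0 s)⁻¹) * (Φ (D + Pd 0 s)⁻¹)⁻¹)
        - (2 : ℂ) • ((Φ (D + Pd 0 s)⁻¹)⁻¹ * Φ ((D + Pd 0 s)⁻¹ * Pd 1 s * (D + Pd 0 s)⁻¹ * Pd 1 s * (D + Pd 0 s)⁻¹) * (Φ (D + Pd 0 s)⁻¹)⁻¹)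
        + (Φ (D + Pd 0 s)⁻¹)⁻¹ * Φ ((D + Pd 0 s)⁻¹ * Pd 2 s * (D + Pd 0 s)⁻¹) * (Φ (D + Pd 0 s)⁻¹)⁻¹ := by
  have hopen := isOpen_resolventCurveSet D Φ hPd
  have hnhds : ∀ᶠ v in 𝓝 s, deriv (fun v : ℝ => (Φ (D + Pd 0 v)⁻¹)⁻¹) v
      = (Φ (D + Pd 0 v)⁻¹)⁻¹ * Φ ((D + Pd 0 v)⁻¹ * Pd 1 v * (D + Pd 0 v)⁻¹) * (Φ (D + Pd 0 v)⁻¹)⁻¹ :=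
    Filter.eventually_of_mem (hopen.mem_nhds ⟨hs, hc⟩) fun v hv => (hasDerivAt_inv_readout_pt D Φ (hPd 0 v) hv.1 hv.2).deriv
  rw [iteratedDeriv_succ, iteratedDeriv_one, Filter.EventuallyEq.deriv_eq hnhds]
  exact (hasDerivAt_firstDiagram_curve D Φ hPd hs hc).deriv

end Curve

/-! ## §2 Two parameters: the mixed partial from separate partial jets -/

section TwoParam

variable {m n : Type*} [Fintype m] [DecidableEq m] [Fintype n] [DecidableEq n]

/-- the good set in the second parameter is a neighbourhood of `r = 0`: if `r ↦ P(0, r)` is differentiable at `0` (hence continuous) and `D + P(0,0)`, `Φ(R(0,0))` are invertible, then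
`D + P(0, r)` and `Φ((D + P(0, r))⁻¹)` are invertible for all `r` near `0`. [folklore] -/
theorem eventually_isUnit_two_param (D : Matrix m m ℂ) (Φ : Matrix m m ℂ →L[ℂ] Matrix n n ℂ) {P : ℝ → ℝ → Matrix m m ℂ} {P01 : Matrix m m ℂ}
    (h01 : HasDerivAt (fun r => P 0 r) P01 0) (h0 : IsUnit (D + P 0 0).det) (hc0 : IsUnit (Φ (D + P 0 0)⁻¹).det) :
    ∀ᶠ r in 𝓝 (0 : ℝ), IsUnit (D + P 0 r).det ∧ IsUnit (Φ (D + P 0 r)⁻¹).det := by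
  have hcont : ContinuousAt (fun r : ℝ => D + P 0 r) 0 := (h01.const_add D).continuousAt
  have h1 : ∀ᶠ r in 𝓝 (0 : ℝ), IsUnit (D + P 0 r).det := by
    have hc : ContinuousAt (fun r : ℝ => (D + P 0 r).det) 0 := (continuous_id.matrix_det.continuousAt).comp hcont
    exact (hc.eventually_ne h0.ne_zero).mono fun r hr => isUnit_iff_ne_zero.mpr hr
  have h2 : ∀ᶠ r in 𝓝 (0 : ℝ), IsUnit (Φ (D + P 0 r)⁻¹).det := by
    have hc : ContinuousAt (fun r : ℝ => (Φ (D + P 0 r)⁻¹).det) 0 :=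
      (continuous_id.matrix_det.continuousAt).comp (hasDerivAt_readout Φ (hasDerivAt_nonsing_inv_real (h01.const_add D) h0)).continuousAt
    exact (hc.eventually_ne hc0.ne_zero).mono fun r hr => isUnit_iff_ne_zero.mpr hr
  exact h1.and h2

/-- **`hasDerivAt_deriv_inv_readout_two_param` — THE MIXED SECOND PARTIAL FROM SEPARATE PARTIAL JETS** [our proof]: let `(s, r) ↦ P(s, r)` be a two-parameter family of perturbations
with `∂_s|₀P(s, r) = P₁₀(r)` for every `r`, `∂_r|₀P(0, r) = P₀₁ =: b`, `∂_r|₀P₁₀(r) = P₁₁ =: c`, `P₁₀(0) = a`, and `D + P(0,0)`, `Φ(R₀)` invertible (`R₀ = (D + P(0,0))⁻¹`, `E₀ = (ΦR₀)⁻¹`).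
THEN `r ↦ ∂_s|₀[(Φ(D + P(s, r))⁻¹)⁻¹]` is differentiable at `r = 0` with derivative
`E₀Φ(R₀bR₀)E₀Φ(R₀aR₀)E₀ + E₀Φ(R₀aR₀)E₀Φ(R₀bR₀)E₀ − E₀Φ(R₀bR₀aR₀)E₀ − E₀Φ(R₀aR₀bR₀)E₀ + E₀Φ(R₀cR₀)E₀` — near `r = 0` the inner derivative IS the first diagram `E(r)Φ(R(r)P₁₀(r)R(r))E(r)`
(`eventually_isUnit_two_param`, `hasDerivAt_inv_readout_pt`), which is differentiated by the product rule (`R(r)′ = −R₀bR₀`, `E(r)′ = E₀Φ(R₀bR₀)E₀`).  No joint differentiability is used. -/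
theorem hasDerivAt_deriv_inv_readout_two_param (D : Matrix m m ℂ) (Φ : Matrix m m ℂ →L[ℂ] Matrix n n ℂ) {P : ℝ → ℝ → Matrix m m ℂ}
    {P10 : ℝ → Matrix m m ℂ} {a P01 P11 : Matrix m m ℂ}
    (h10 : ∀ r, HasDerivAt (fun s => P s r) (P10 r) 0) (ha : P10 0 = a) (h01 : HasDerivAt (fun r => P 0 r) P01 0) (h11 : HasDerivAt P10 P11 0)
    (h0 : IsUnit (D + P 0 0).det) (hc0 : IsUnit (Φ (D + P 0 0)⁻¹).det) :
    HasDerivAt (fun r => deriv (fun s => (Φ (D + P s r)⁻¹)⁻¹) 0)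
      ((Φ (D + P 0 0)⁻¹)⁻¹ * Φ ((D + P 0 0)⁻¹ * P01 * (D + P 0 0)⁻¹) * (Φ (D + P 0 0)⁻¹)⁻¹ * Φ ((D + P 0 0)⁻¹ * a * (D + P 0 0)⁻¹) * (Φ (D + P 0 0)⁻¹)⁻¹
        + (Φ (D + P 0 0)⁻¹)⁻¹ * Φ ((D + P 0 0)⁻¹ * a * (D + P 0 0)⁻¹) * (Φ (D + P 0 0)⁻¹)⁻¹ * Φ ((D + P 0 0)⁻¹ * P01 * (D + P 0 0)⁻¹) * (Φ (D + P 0 0)⁻¹)⁻¹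
        - (Φ (D + P 0 0)⁻¹)⁻¹ * Φ ((D + P 0 0)⁻¹ * P01 * (D + P 0 0)⁻¹ * a * (D + P 0 0)⁻¹) * (Φ (D + P 0 0)⁻¹)⁻¹
        - (Φ (D + P 0 0)⁻¹)⁻¹ * Φ ((D + P 0 0)⁻¹ * a * (D + P 0 0)⁻¹ * P01 * (D + P 0 0)⁻¹) * (Φ (D + P 0 0)⁻¹)⁻¹
        + (Φ (D + P 0 0)⁻¹)⁻¹ * Φ ((D + P 0 0)⁻¹ * P11 * (D + P 0 0)⁻¹) * (Φ (D + P 0 0)⁻¹)⁻¹) 0 := by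
  -- near `r = 0` the inner derivative is the first diagram
  have hev := eventually_isUnit_two_param D Φ h01 h0 hc0
  have hform : (fun r => deriv (fun s => (Φ (D + P s r)⁻¹)⁻¹) 0) =ᶠ[𝓝 (0 : ℝ)]
      fun r => (Φ (D + P 0 r)⁻¹)⁻¹ * Φ ((D + P 0 r)⁻¹ * P10 r * (D + P 0 r)⁻¹) * (Φ (D + P 0 r)⁻¹)⁻¹ :=
    hev.mono fun r hr => (hasDerivAt_inv_readout_pt D Φ (P := fun s => P s r) (h10 r) hr.1 hr.2).deriv
  -- the three factors of the first diagram are differentiable in `r` at `0`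
  have hR : HasDerivAt (fun r : ℝ => (D + P 0 r)⁻¹) (-((D + P 0 0)⁻¹ * P01 * (D + P 0 0)⁻¹)) 0 := hasDerivAt_nonsing_inv_real (h01.const_add D) h0
  have hE : HasDerivAt (fun r : ℝ => (Φ (D + P 0 r)⁻¹)⁻¹) ((Φ (D + P 0 0)⁻¹)⁻¹ * Φ ((D + P 0 0)⁻¹ * P01 * (D + P 0 0)⁻¹) * (Φ (D + P 0 0)⁻¹)⁻¹) 0 :=
    hasDerivAt_inv_readout_pt D Φ (P := fun r => P 0 r) h01 h0 hc0
  have hW := (hR.fun_mul h11).fun_mul hR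
  have h := (hE.fun_mul (hasDerivAt_readout Φ hW)).fun_mul hE
  refine (h.congr_deriv ?_).congr_of_eventuallyEq hform
  rw [ha]
  simp only [map_add, map_neg, Matrix.mul_add, Matrix.add_mul, Matrix.mul_neg, Matrix.neg_mul, Matrix.mul_assoc]
  abel

/-- **`deriv_deriv_inv_readout_two_param`** — `deriv` form: the mixed partial `∂_r|₀∂_s|₀[(Φ(D + P(s, r))⁻¹)⁻¹]` is the explicit five-diagram combination. [our proof] -/
theorem deriv_deriv_inv_readout_two_param (D : Matrix m m ℂ) (Φ : Matrix m m ℂ →L[ℂ] Matrix n n ℂ) {P : ℝ → ℝ → Matrix m m ℂ}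
    {P10 : ℝ → Matrix m m ℂ} {a P01 P11 : Matrix m m ℂ}
    (h10 : ∀ r, HasDerivAt (fun s => P s r) (P10 r) 0) (ha : P10 0 = a) (h01 : HasDerivAt (fun r => P 0 r) P01 0) (h11 : HasDerivAt P10 P11 0)
    (h0 : IsUnit (D + P 0 0).det) (hc0 : IsUnit (Φ (D + P 0 0)⁻¹).det) :
    deriv (fun r => deriv (fun s => (Φ (D + P s r)⁻¹)⁻¹) 0) 0
      = (Φ (D + P 0 0)⁻¹)⁻¹ * Φ ((D + P 0 0)⁻¹ * P01 * (D + P 0 0)⁻¹) * (Φ (D + P 0 0)⁻¹)⁻¹ * Φ ((D + P 0 0)⁻¹ * a * (D + P 0 0)⁻¹) * (Φ (D + P 0 0)⁻¹)⁻¹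
        + (Φ (D + P 0 0)⁻¹)⁻¹ * Φ ((D + P 0 0)⁻¹ * a * (D + P 0 0)⁻¹) * (Φ (D + P 0 0)⁻¹)⁻¹ * Φ ((D + P 0 0)⁻¹ * P01 * (D + P 0 0)⁻¹) * (Φ (D + P 0 0)⁻¹)⁻¹
        - (Φ (D + P 0 0)⁻¹)⁻¹ * Φ ((D + P 0 0)⁻¹ * P01 * (D + P 0 0)⁻¹ * a * (D + P 0 0)⁻¹) * (Φ (D + P 0 0)⁻¹)⁻¹
        - (Φ (D + P 0 0)⁻¹)⁻¹ * Φ ((D + P 0 0)⁻¹ * a * (D + P 0 0)⁻¹ * P01 * (D + P 0 0)⁻¹) * (Φ (D + P 0 0)⁻¹)⁻¹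
        + (Φ (D + P 0 0)⁻¹)⁻¹ * Φ ((D + P 0 0)⁻¹ * P11 * (D + P 0 0)⁻¹) * (Φ (D + P 0 0)⁻¹)⁻¹ :=
  (hasDerivAt_deriv_inv_readout_two_param D Φ h10 ha h01 h11 h0 hc0).deriv

end TwoParam

/-! ## §3 The polarisation identity (algebra) -/

section Polarisation

variable {m n : Type*} [Fintype m] [Fintype n]

/-- **`two_smul_mixedDiagram_eq_polarisation` — POLARISATION, ALGEBRAIC FORM**: for any matrices `E, R, a, b, c, a₂, b₂` and any linear read-out `Φ`, with `p = a + b` and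
`q = a₂ + 2c + b₂` (the first and second jets of the diagonal curve),
`2·[EΦ(RbR)EΦ(RaR)E + EΦ(RaR)EΦ(RbR)E − EΦ(RbRaR)E − EΦ(RaRbR)E + EΦ(RcR)E] = S(p, q) − S(a, a₂) − S(b, b₂)`,
`S(x, y) = 2·EΦ(RxR)EΦ(RxR)E − 2·EΦ(RxRxR)E + EΦ(RyR)E` (bilinearity of the second diagram sum in its letters). [folklore] -/
theorem two_smul_mixedDiagram_eq_polarisation (Φ : Matrix m m ℂ →L[ℂ] Matrix n n ℂ) (E : Matrix n n ℂ) (R a b c a₂ b₂ p q : Matrix m m ℂ)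
    (hp : p = a + b) (hq : q = a₂ + (2 : ℂ) • c + b₂) :
    (2 : ℂ) • (E * Φ (R * b * R) * E * Φ (R * a * R) * E + E * Φ (R * a * R) * E * Φ (R * b * R) * E
        - E * Φ (R * b * R * a * R) * E - E * Φ (R * a * R * b * R) * E + E * Φ (R * c * R) * E)
      = ((2 : ℂ) • (E * Φ (R * p * R) * E * Φ (R * p * R) * E) - (2 : ℂ) • (E * Φ (R * p * R * p * R) * E) + E * Φ (R * q * R) * E)
        - ((2 : ℂ) • (E * Φ (R * a * R) * E * Φ (R * a * R) * E) - (2 : ℂ) • (E * Φ (R * a * R * a * R) * E) + E * Φ (R * a₂ * R) * E)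
        - ((2 : ℂ) • (E * Φ (R * b * R) * E * Φ (R * b * R) * E) - (2 : ℂ) • (E * Φ (R * b * R * b * R) * E) + E * Φ (R * b₂ * R) * E) := by
  subst hp hq
  simp only [two_smul, Matrix.mul_add, Matrix.add_mul, map_add, Matrix.mul_assoc]
  abel

/-- **`mixedDiagram_eq_half_polarisation` — POLARISATION**: the five-diagram combination is `½(S(a + b, a₂ + 2c + b₂) − S(a, a₂) − S(b, b₂))`. [folklore] -/
theorem mixedDiagram_eq_half_polarisation (Φ : Matrix m m ℂ →L[ℂ] Matrix n n ℂ) (E : Matrix n n ℂ) (R a b c a₂ b₂ p q : Matrix m m ℂ)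
    (hp : p = a + b) (hq : q = a₂ + (2 : ℂ) • c + b₂) :
    E * Φ (R * b * R) * E * Φ (R * a * R) * E + E * Φ (R * a * R) * E * Φ (R * b * R) * E
        - E * Φ (R * b * R * a * R) * E - E * Φ (R * a * R * b * R) * E + E * Φ (R * c * R) * E
      = (1 / 2 : ℂ) • (((2 : ℂ) • (E * Φ (R * p * R) * E * Φ (R * p * R) * E) - (2 : ℂ) • (E * Φ (R * p * R * p * R) * E) + E * Φ (R * q * R) * E)
        - ((2 : ℂ) • (E * Φ (R * a * R) * E * Φ (R * a * R) * E) - (2 : ℂ) • (E * Φ (R * a * R * a * R) * E) + E * Φ (R * a₂ * R) * E)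
        - ((2 : ℂ) • (E * Φ (R * b * R) * E * Φ (R * b * R) * E) - (2 : ℂ) • (E * Φ (R * b * R * b * R) * E) + E * Φ (R * b₂ * R) * E)) := by
  rw [← two_smul_mixedDiagram_eq_polarisation Φ E R a b c a₂ b₂ p q hp hq, smul_smul]
  norm_num

end Polarisation

/-! ## §4 The mixed partial is the polarisation of the three one-parameter second derivatives -/

section Compose

variable {m n : Type*} [Fintype m] [DecidableEq m] [Fintype n] [DecidableEq n]

/-- **`deriv_deriv_eq_half_polarisation` — THE MIXED PARTIAL OF A TWO-PARAMETER FAMILY IS HALF THE POLARISATION OF THE SECOND DERIVATIVES ALONG THE DIAGONAL AND THE TWO AXES**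
[our proof]: two-parameter data as in `deriv_deriv_inv_readout_two_param` (`a = P₁₀(0)`, `b = P₀₁`, `c = P₁₁`), and three jet-tower curves `P^A, P^B, P^{AB}` through the same base
point `P(0,0)` with first jets `a, b, a + b` and second jets `a₂, b₂, a₂ + 2c + b₂` at `0`.  THEN
`∂_r|₀∂_s|₀[(Φ(D + P(s, r))⁻¹)⁻¹] = ½(∂²_v|₀[(Φ(D + P^{AB}(v)))⁻¹)⁻¹] − ∂²_v|₀[(Φ(D + P^A(v)))⁻¹)⁻¹] − ∂²_v|₀[(Φ(D + P^B(v)))⁻¹)⁻¹])` — for the exponential chart of a sum of two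
connections, `U_{s,r} = exp(iη(sA + rB))`, the three curves are the charts of `A + B`, `A`, `B` (PART 252 ∕ 253): the one-loop Hessian is the polarisation of PART 247's `N = 2`. -/
theorem deriv_deriv_eq_half_polarisation (D : Matrix m m ℂ) (Φ : Matrix m m ℂ →L[ℂ] Matrix n n ℂ) {P : ℝ → ℝ → Matrix m m ℂ}
    {P10 : ℝ → Matrix m m ℂ} {a P01 P11 : Matrix m m ℂ}
    (h10 : ∀ r, HasDerivAt (fun s => P s r) (P10 r) 0) (ha : P10 0 = a) (h01 : HasDerivAt (fun r => P 0 r) P01 0) (h11 : HasDerivAt P10 P11 0)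
    (h0 : IsUnit (D + P 0 0).det) (hc0 : IsUnit (Φ (D + P 0 0)⁻¹).det)
    {PA PB PAB : ℕ → ℝ → Matrix m m ℂ} (hPA : ∀ j v, HasDerivAt (PA j) (PA (j + 1) v) v) (hPB : ∀ j v, HasDerivAt (PB j) (PB (j + 1) v) v)
    (hPAB : ∀ j v, HasDerivAt (PAB j) (PAB (j + 1) v) v) (hA0 : PA 0 0 = P 0 0) (hB0 : PB 0 0 = P 0 0) (hAB0 : PAB 0 0 = P 0 0)
    (hA1 : PA 1 0 = a) (hB1 : PB 1 0 = P01) (hAB1 : PAB 1 0 = a + P01) (hAB2 : PAB 2 0 = PA 2 0 + (2 : ℂ) • P11 + PB 2 0) :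
    deriv (fun r => deriv (fun s => (Φ (D + P s r)⁻¹)⁻¹) 0) 0
      = (1 / 2 : ℂ) • (iteratedDeriv 2 (fun v : ℝ => (Φ (D + PAB 0 v)⁻¹)⁻¹) 0 - iteratedDeriv 2 (fun v : ℝ => (Φ (D + PA 0 v)⁻¹)⁻¹) 0
          - iteratedDeriv 2 (fun v : ℝ => (Φ (D + PB 0 v)⁻¹)⁻¹) 0) := by
  have hA0' : IsUnit (D + PA 0 0).det := by rw [hA0]; exact h0
  have hA0'' : IsUnit (Φ (D + PA 0 0)⁻¹).det := by rw [hA0]; exact hc0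
  have hB0' : IsUnit (D + PB 0 0).det := by rw [hB0]; exact h0
  have hB0'' : IsUnit (Φ (D + PB 0 0)⁻¹).det := by rw [hB0]; exact hc0
  have hAB0' : IsUnit (D + PAB 0 0).det := by rw [hAB0]; exact h0
  have hAB0'' : IsUnit (Φ (D + PAB 0 0)⁻¹).det := by rw [hAB0]; exact hc0
  rw [deriv_deriv_inv_readout_two_param D Φ h10 ha h01 h11 h0 hc0, iteratedDeriv_two_inv_readout_curve D Φ hPAB hAB0' hAB0'',
    iteratedDeriv_two_inv_readout_curve D Φ hPA hA0' hA0'', iteratedDeriv_two_inv_readout_curve D Φ hPB hB0' hB0'', hA0, hB0, hAB0, hA1, hB1, hAB1, hAB2]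
  exact mixedDiagram_eq_half_polarisation Φ _ _ a P01 P11 (PA 2 0) (PB 2 0) _ _ rfl rfl

end Compose

end Summit.QuantumFields.BalabanUV.Beta.GAN24.ResolventMixedPartials

end
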